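import Mathlib
import Summits.AtomisticToContinuum.HydrodynamicLimit.Theorems.ImplosionDichotomyDenseExcursionSonicSmoothBranchCkPair

/-!
# The analytic Frobenius pair at the sonic point under a quantified gap `‖n ∓ ν‖ ≥ μ`
# (crux `DenseExcursion`, line `sonic-cavity-renewal`, brick for stub `stub_cavityResolventCk`, theorem T2/T6b)

Helper file (`--supports stmt-AtomisticToContinuum-12586`, line lead a2, stub-worker E1 for `stub_cavityResolventCk`).
Verbatim the construction of `…SonicSmoothBranchCkPair` (`frobenius_pair_of_series`: the two analytic Frobenius branches
`(a₁, a₂)` (exponent `0`) and `(ψ₁, ψ₂ = xχ)` (`x ψ′ = (N − ν)ψ`) of the first-kind singular system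
`x v′ = N(Λ, x) v`, `N(Λ, 0) = [[ν, β₀],[0, 0]]`, via `Literature.Analysis.ODE.IsFrobeniusData.analyticBranch`, with radius
and `C^k` bounds uniform in the data `(C₀, θ, R, μ, ν_M, b, k)`), with the single change that the non-resonance of the
pivots `1/(n − ν)`, `1/(n + ν)`, `1/ν` is quantified by the GAP HYPOTHESIS `‖n − ν‖ ≥ μ`, `‖n + ν‖ ≥ μ` for all `n : ℕ`
(`gap_norm_inv_sub_le`: then `‖1/(n ∓ ν)‖ ≤ (1 + ν_M/μ)/n`) instead of `|Im ν| ≥ μ` (registered helper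
`frobenius_pair_of_series_gap`). This covers real non-integral exponents `ν` — the real spectral parameters of the
cavity resolvent off the set `ν(Λ) ∈ ℤ`. Sources: Coddington–Levinson 1955 Ch. 4 (folklore).
-/

noncomputable section

open Set Filter
open scoped Topology ContDiff NNReal

namespace Summit.AtomisticToContinuum.HydrodynamicLimit.Theorems.SonicCavityRenewal

open Literature.Analysis.ODE

/-- The `2 × 2` complex matrix `[[a, b],[c, d]]` acting on `ℂ × ℂ`, as a continuous linear map. -/
local notation "𝐌[" a ", " b ", " c ", " d "]" =>
  ((a : ℂ) • ContinuousLinearMap.comp (ContinuousLinearMap.inl ℂ ℂ ℂ) (ContinuousLinearMap.fst ℂ ℂ ℂ) +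
    (b : ℂ) • ContinuousLinearMap.comp (ContinuousLinearMap.inl ℂ ℂ ℂ) (ContinuousLinearMap.snd ℂ ℂ ℂ) +
    (c : ℂ) • ContinuousLinearMap.comp (ContinuousLinearMap.inr ℂ ℂ ℂ) (ContinuousLinearMap.fst ℂ ℂ ℂ) +
    (d : ℂ) • ContinuousLinearMap.comp (ContinuousLinearMap.inr ℂ ℂ ℂ) (ContinuousLinearMap.snd ℂ ℂ ℂ))

/-- QUANTIFIED NON-RESONANCE FROM A GAP: if `‖n − s‖ ≥ μ > 0` and `‖s‖ ≤ ν_M` then `n ≤ (1 + ν_M/μ)‖n − s‖`. [folklore] -/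
theorem gap_natCast_le_mul_norm_sub {s : ℂ} {μ νM : ℝ} (hμ : 0 < μ) {n : ℕ} (hμs : μ ≤ ‖(n : ℂ) - s‖)
    (hsM : ‖s‖ ≤ νM) : (n : ℝ) ≤ (1 + νM / μ) * ‖(n : ℂ) - s‖ := by
  have h1 : (n : ℝ) - νM ≤ ‖(n : ℂ) - s‖ := by
    have := norm_sub_norm_le (n : ℂ) s; rw [Complex.norm_natCast] at this; linarith
  have hνM : 0 ≤ νM := (norm_nonneg s).trans hsM
  calc (n : ℝ) = ((n : ℝ) - νM) + νM := by ring
    _ ≤ ‖(n : ℂ) - s‖ + νM / μ * μ := by rw [div_mul_cancel₀ _ hμ.ne']; linarith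
    _ ≤ ‖(n : ℂ) - s‖ + νM / μ * ‖(n : ℂ) - s‖ := by gcongr
    _ = (1 + νM / μ) * ‖(n : ℂ) - s‖ := by ring

/-- The resolvent bound `‖1/(n − s)‖ ≤ (1 + ν_M/μ)/n` for `n ≥ 1` from the gap `‖n − s‖ ≥ μ`. [folklore] -/
theorem gap_norm_inv_sub_le {s : ℂ} {μ νM : ℝ} (hμ : 0 < μ) {n : ℕ} (hμs : μ ≤ ‖(n : ℂ) - s‖) (hsM : ‖s‖ ≤ νM)
    (hn : 1 ≤ n) : (n : ℂ) - s ≠ 0 ∧ ‖((n : ℂ) - s)⁻¹‖ ≤ (1 + νM / μ) / n := by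
  have hne : (n : ℂ) - s ≠ 0 := fun h => by rw [h, norm_zero] at hμs; linarith
  refine ⟨hne, ?_⟩
  rw [norm_inv, inv_eq_one_div, div_le_div_iff₀ (norm_pos_iff.2 hne) (by exact_mod_cast hn), one_mul]
  exact gap_natCast_le_mul_norm_sub hμ hμs hsM

/-- **Registered helper `frobenius_pair_of_series_gap`: THE ANALYTIC FROBENIUS PAIR UNDER A QUANTIFIED GAP, UNIFORMLY IN
THE SPECTRAL PARAMETER.** See the module docstring. [cite: CoddingtonLevinson1955, Ch. 4] -/
theorem frobenius_pair_of_series_gap : ∀ (C₀ θ R μ νM b : ℝ) (k : ℕ), 0 ≤ C₀ → 0 < θ → 0 ≤ R → 0 < μ → 0 ≤ νM → 0 ≤ b → ∃ ρ : ℝ, 0 < ρ ∧ ∃ Cb : ℝ, 0 ≤ Cb ∧ ∀ (e : Fin 6 → ℕ → ℝ) (Λ : ℂ), (∀ i n, |e i n| ≤ C₀ * θ ^ n) → ‖Λ‖ ≤ R → (∀ n : ℕ, μ ≤ ‖(n : ℂ) - (Λ * (e 0 0 : ℂ) - (e 2 0 : ℂ))‖ ∧ μ ≤ ‖(n : ℂ)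 + (Λ * (e 0 0 : ℂ) - (e 2 0 : ℂ))‖) → ‖Λ * (e 0 0 : ℂ) - (e 2 0 : ℂ)‖ ≤ νM → |e 3 0| ≤ b → e 1 0 = 0 → e 4 0 = 0 → e 5 0 = 0 → ∃ (a₁ a₂ ψ₁ ψ₂ χ : ℝ → ℂ), ContDiffOn ℝ ∞ a₁ (Set.Ioo (-ρ) ρ) ∧ ContDiffOn ℝ ∞ a₂ (Set.Ioo (-ρ) ρ) ∧ ContDiffOn ℝ ∞ ψ₁ (Set.Ioo (-ρ) ρ) ∧ ContDiffOn ℝ ∞ ψ₂ (Set.Ioo (-ρ) ρ) ∧ ContDiffOn ℝ ∞ χ (Set.Ioo (-ρ) ρ) ∧ a₂ 0 = 1 ∧ ψ₁ 0 = 1 ∧ (∀ x ∈ Set.Ioo (-ρ) ρ, ψ₂ x = (x : ℂ) * χ x) ∧ (∀ x ∈ Set.Ioo (-ρ) ρ, ∀ (m₁₁ m₁₂ m₂₁ m₂₂ : ℂ), HasSum (fun n => (x : ℂ) ^ n * (Λ * (e 0 n : ℂ) - (e 2 n : ℂ))) m₁₁ → HasSum (fun n => (x : ℂ) ^ n * (-(e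 3 n : ℂ))) m₁₂ → HasSum (fun n => (x : ℂ) ^ n * (-(e 4 n : ℂ))) m₂₁ → HasSum (fun n => (x : ℂ) ^ n * (Λ * (e 1 n : ℂ) - (e 5 n : ℂ))) m₂₂ → ((x : ℂ) * deriv a₁ x = m₁₁ * a₁ x + m₁₂ * a₂ x ∧ (x : ℂ) * deriv a₂ x = m₂₁ * a₁ x + m₂₂ * a₂ x) ∧ ((x : ℂ) * deriv ψ₁ x = (m₁₁ - (Λ * (e 0 0 : ℂ) - (e 2 0 : ℂ))) * ψ₁ x + m₁₂ * ψ₂ x ∧ (x : ℂ) * deriv ψ₂ x = m₂₁ * ψ₁ x + (m₂₂ - (Λ * (e 0 0 : ℂ) - (e 2 0 : ℂ))) * ψ₂ x)) ∧ (∀ x ∈ Set.Ioo (-ρ) ρ, ‖a₁ x * ψ₂ x - a₂ x * ψ₁ x + 1‖ ≤ 1 / 2) ∧ ∀ i : ℕ, i ≤ k → ∀ x ∈ Set.Ioo (-ρ) ρ, ‖iteratedDeriv i a₁ x‖ ≤ Cb ∧ ‖iteratedDeriv i a₂ x‖ ≤ Cb ∧ ‖iteratedDeriv i ψ₁ x‖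 ≤ Cb ∧ ‖iteratedDeriv i ψ₂ x‖ ≤ Cb ∧ ‖iteratedDeriv i χ x‖ ≤ Cb := by
  intro C₀ θ R μ νM b k hC₀ hθ hR hμ hνM hb
  -- the uniform majorant constants (opaque names with defining equations)
  obtain ⟨c₁, hc₁⟩ : ∃ c₁ : ℝ, c₁ = 1 + νM / μ := ⟨_, rfl⟩
  have hc₁0 : 0 ≤ c₁ := by rw [hc₁]; positivity
  obtain ⟨cR, hcR⟩ : ∃ cR : ℝ, cR = c₁ + b * c₁ + 1 := ⟨_, rfl⟩
  have hcR0 : 0 ≤ cR := by rw [hcR]; positivity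
  obtain ⟨K, hK⟩ : ∃ K : ℝ, K = (2 * R + 4) * C₀ := ⟨_, rfl⟩
  have hK0 : 0 ≤ K := by rw [hK]; positivity
  obtain ⟨lam, hlam⟩ : ∃ lam : ℝ, lam = θ * (1 + 2 * cR * K) := ⟨_, rfl⟩
  have hlam0 : 0 < lam := by rw [hlam]; positivity
  obtain ⟨Bst, hBst⟩ : ∃ Bst : ℝ, Bst = 8 * (1 + b) * (1 + μ⁻¹) + lam := ⟨_, rfl⟩
  have hμi : 0 < μ⁻¹ := inv_pos.2 hμ
  have hE : (1 + b) * (1 + μ⁻¹) = 1 + b + μ⁻¹ + b * μ⁻¹ := by ring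
  have hbμ : 0 ≤ b * μ⁻¹ := mul_nonneg hb hμi.le
  have h8 : 0 ≤ 8 * (1 + b) * (1 + μ⁻¹) := by positivity
  have hBst1 : 8 * (1 + b) * (1 + μ⁻¹) ≤ Bst := by rw [hBst]; linarith
  have hBst2 : lam ≤ Bst := by rw [hBst]; linarith
  have hBst3 : 1 ≤ Bst := by rw [hBst, mul_assoc, hE]; linarith [hμi.le]
  have hBst0 : 0 ≤ Bst := by linarith
  obtain ⟨Cs, hCs0, hCs⟩ := scalar_series_package lam (k + 1) hlam0
  obtain ⟨ρ₁, hρ₁⟩ : ∃ ρ₁ : ℝ, ρ₁ = 1 / (2 ^ (k + 1 + 1) * lam) := ⟨_, rfl⟩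
  have hρ₁0 : 0 < ρ₁ := by rw [hρ₁]; positivity
  obtain ⟨Cb, hCb⟩ : ∃ Cb : ℝ, Cb = Cs * Bst := ⟨_, rfl⟩
  have hCb0 : 0 ≤ Cb := by rw [hCb]; positivity
  obtain ⟨ρ, hρ⟩ : ∃ ρ : ℝ, ρ = min ρ₁ (1 / (8 * Cb ^ 2 + 8)) := ⟨_, rfl⟩
  have hρ0 : 0 < ρ := by rw [hρ]; exact lt_min hρ₁0 (by positivity)
  have hρρ₁ : ρ ≤ ρ₁ := by rw [hρ]; exact min_le_left _ _
  have hρCb : ρ ≤ 1 / (8 * Cb ^ 2 + 8) := by rw [hρ]; exact min_le_right _ _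
  rw [← hρ₁] at hCs
  refine ⟨ρ, hρ0, Cb, hCb0, fun e Λ he hΛ hμν hνν hbe he1 he4 he5 => ?_⟩
  -- STEP 0: the exponent `ν`, the coupling `β₀`, the datum `v₀`
  obtain ⟨ν, hν⟩ : ∃ ν : ℂ, ν = Λ * (e 0 0 : ℂ) - (e 2 0 : ℂ) := ⟨_, rfl⟩
  rw [← hν] at hμν hνν ⊢
  obtain ⟨β₀, hβ₀⟩ : ∃ β₀ : ℂ, β₀ = -(e 3 0 : ℂ) := ⟨_, rfl⟩
  have hμν0 : μ ≤ ‖ν‖ := by simpa using (hμν 0).1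
  have hν0 : ν ≠ 0 := fun h => by rw [h, norm_zero] at hμν0; linarith
  have hβ₀b : ‖β₀‖ ≤ b := by rw [hβ₀, norm_neg, Complex.norm_real, Real.norm_eq_abs]; exact hbe
  have hνinv : ‖ν⁻¹‖ ≤ μ⁻¹ := by rw [norm_inv]; exact inv_anti₀ hμ hμν0
  obtain ⟨v₀, hv₀⟩ : ∃ v₀ : ℂ × ℂ, v₀ = (-(β₀ * ν⁻¹), 1) := ⟨_, rfl⟩
  have hv₀norm : ‖v₀‖ ≤ Bst := by
    refine le_trans ?_ hBst1
    rw [hv₀, Prod.norm_mk]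
    refine max_le ?_ ?_
    · rw [norm_neg, norm_mul]
      calc ‖β₀‖ * ‖ν⁻¹‖ ≤ b * μ⁻¹ := mul_le_mul hβ₀b hνinv (norm_nonneg _) hb
        _ ≤ 8 * (1 + b) * (1 + μ⁻¹) := by rw [mul_assoc, hE]; linarith
    · rw [norm_one, mul_assoc, hE]; linarith
  -- STEP 1: the coefficient operators and their majorant
  obtain ⟨N, hN⟩ : ∃ N : ℕ → (ℂ × ℂ →L[ℂ] ℂ × ℂ), N = fun n : ℕ =>
      𝐌[Λ * (e 0 n : ℂ) - (e 2 n : ℂ), -(e 3 n : ℂ), -(e 4 n : ℂ), Λ * (e 1 n : ℂ) - (e 5 n : ℂ)] := ⟨_, rfl⟩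
  have hce : ∀ i n, ‖(e i n : ℂ)‖ ≤ C₀ * θ ^ n := fun i n => by rw [Complex.norm_real, Real.norm_eq_abs]; exact he i n
  have hNnorm : ∀ n, ‖N n‖ ≤ K * θ ^ n := by
    intro n
    have h1 : ∀ i j, ‖Λ * (e i n : ℂ) - (e j n : ℂ)‖ ≤ R * (C₀ * θ ^ n) + C₀ * θ ^ n := fun i j =>
      (norm_sub_le _ _).trans (add_le_add (by rw [norm_mul]; exact mul_le_mul hΛ (hce i n) (norm_nonneg _) hR) (hce j n))
    rw [hN]
    calc _ ≤ ‖Λ * (e 0 n : ℂ) - (e 2 n : ℂ)‖ + ‖-(e 3 n : ℂ)‖ + ‖-(e 4 n : ℂ)‖ + ‖Λ * (e 1 n : ℂ) - (e 5 n : ℂ)‖ :=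
          norm_sbMat_le _ _ _ _
      _ ≤ (R * (C₀ * θ ^ n) + C₀ * θ ^ n) + C₀ * θ ^ n + C₀ * θ ^ n + (R * (C₀ * θ ^ n) + C₀ * θ ^ n) := by
          rw [norm_neg, norm_neg]; exact add_le_add (add_le_add (add_le_add (h1 0 2) (hce 3 n)) (hce 4 n)) (h1 1 5)
      _ = K * θ ^ n := by rw [hK]; ring
  have hN0 : N 0 = 𝐌[ν, β₀, 0, 0] := by
    rw [hN, hν, hβ₀]; simp only [he4, he5, he1]; push_cast; simp
  -- the inverses `Rₙ`, `R'ₙ` and their uniform bounds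
  have hRn : ∀ n : ℕ, 1 ≤ n → ((n : ℂ) - ν ≠ 0 ∧ ‖((n : ℂ) - ν)⁻¹‖ ≤ c₁ / n) ∧
      ((n : ℂ) + ν ≠ 0 ∧ ‖((n : ℂ) + ν)⁻¹‖ ≤ c₁ / n) := by
    intro n hn
    rw [hc₁]
    refine ⟨gap_norm_inv_sub_le hμ (hμν n).1 hνν hn, ?_⟩
    have := gap_norm_inv_sub_le (s := -ν) hμ (n := n) (by simpa [sub_neg_eq_add] using (hμν n).2)
      (by simpa using hνν) hn
    simpa [sub_neg_eq_add] using this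
  obtain ⟨Rφ, hRφ⟩ : ∃ Rφ : ℕ → (ℂ × ℂ →L[ℂ] ℂ × ℂ), Rφ = fun n : ℕ =>
      𝐌[((n : ℂ) - ν)⁻¹, β₀ * (((n : ℂ) - ν)⁻¹ * (n : ℂ)⁻¹), 0, (n : ℂ)⁻¹] := ⟨_, rfl⟩
  obtain ⟨Rψ, hRψ⟩ : ∃ Rψ : ℕ → (ℂ × ℂ →L[ℂ] ℂ × ℂ), Rψ = fun n : ℕ =>
      𝐌[(n : ℂ)⁻¹, β₀ * (((n : ℂ) + ν)⁻¹ * (n : ℂ)⁻¹), 0, ((n : ℂ) + ν)⁻¹] := ⟨_, rfl⟩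
  have hRbound : ∀ n : ℕ, 1 ≤ n → ‖Rφ n‖ ≤ cR / n ∧ ‖Rψ n‖ ≤ cR / n := by
    intro n hn
    obtain ⟨⟨-, hle⟩, ⟨-, hle'⟩⟩ := hRn n hn
    have hn0 : (0 : ℝ) < n := by exact_mod_cast hn
    have hninv : ‖(n : ℂ)⁻¹‖ = 1 / n := by rw [norm_inv, Complex.norm_natCast, one_div]
    have hninv1 : ‖(n : ℂ)⁻¹‖ ≤ 1 := by rw [hninv, div_le_one hn0]; exact_mod_cast hn
    have key : ∀ t : ℂ, ‖t‖ ≤ c₁ / n → ‖β₀ * (t * (n : ℂ)⁻¹)‖ ≤ b * (c₁ / n) := fun t ht => by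
      rw [norm_mul, norm_mul]
      calc ‖β₀‖ * (‖t‖ * ‖(n : ℂ)⁻¹‖) ≤ b * (c₁ / n * 1) :=
            mul_le_mul hβ₀b (mul_le_mul ht hninv1 (norm_nonneg _) (by positivity)) (by positivity) hb
        _ = b * (c₁ / n) := by ring
    rw [hRφ, hRψ]
    constructor
    · calc _ ≤ ‖((n : ℂ) - ν)⁻¹‖ + ‖β₀ * (((n : ℂ) - ν)⁻¹ * (n : ℂ)⁻¹)‖ + ‖(0 : ℂ)‖ + ‖(n : ℂ)⁻¹‖ :=
            norm_sbMat_le _ _ _ _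
        _ ≤ c₁ / n + b * (c₁ / n) + 0 + 1 / n := by rw [norm_zero, hninv]; gcongr; exact key _ hle
        _ = cR / n := by rw [hcR]; ring
    · calc _ ≤ ‖(n : ℂ)⁻¹‖ + ‖β₀ * (((n : ℂ) + ν)⁻¹ * (n : ℂ)⁻¹)‖ + ‖(0 : ℂ)‖ + ‖((n : ℂ) + ν)⁻¹‖ :=
            norm_sbMat_le _ _ _ _
        _ ≤ 1 / n + b * (c₁ / n) + 0 + c₁ / n := by rw [norm_zero, hninv]; gcongr; exact key _ hle'
        _ = cR / n := by rw [hcR]; ring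
  -- STEP 2: the two Frobenius data
  have hDφ : IsFrobeniusData (𝕜 := ℂ) N (fun _ => (0 : ℂ × ℂ)) Rφ v₀ θ K 0 cR :=
    { a_nonneg := hθ.le
      K_nonneg := hK0
      G_nonneg := le_rfl
      c_nonneg := hcR0
      norm_M_le := fun n _ => hNnorm n
      norm_g_le := fun n _ => by rw [norm_zero]; positivity
      rightInverse := fun n hn w => by
        obtain ⟨⟨hne, -⟩, -⟩ := hRn n hn
        have hn0 : (n : ℂ) ≠ 0 := by exact_mod_cast (show n ≠ 0 by omega)
        rw [hN0, hRφ]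
        exact sbMat_rightInverse_phi hne hn0 w
      norm_R_le := fun n hn => (hRbound n hn).1
      compat := by rw [hN0, hv₀, add_zero]; exact (sbMat_compat (β₀ := β₀) hν0).1 }
  obtain ⟨M', hM'⟩ : ∃ M' : ℕ → (ℂ × ℂ →L[ℂ] ℂ × ℂ), M' = fun n => if n = 0 then 𝐌[0, β₀, 0, -ν] else N n :=
    ⟨_, rfl⟩
  have hDψ : IsFrobeniusData (𝕜 := ℂ) M' (fun _ => (0 : ℂ × ℂ)) Rψ ((1 : ℂ), (0 : ℂ)) θ K 0 cR :=
    { a_nonneg := hθ.le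
      K_nonneg := hK0
      G_nonneg := le_rfl
      c_nonneg := hcR0
      norm_M_le := fun n hn => by rw [hM']; simp only [if_neg (show n ≠ 0 by omega)]; exact hNnorm n
      norm_g_le := fun n _ => by rw [norm_zero]; positivity
      rightInverse := fun n hn w => by
        obtain ⟨-, ⟨hne, -⟩⟩ := hRn n hn
        have hn0 : (n : ℂ) ≠ 0 := by exact_mod_cast (show n ≠ 0 by omega)
        rw [hM', hRψ]
        simp only [if_true]
        exact sbMat_rightInverse_psi hne hn0 w
      norm_R_le := fun n hn => (hRbound n hn).2
      compat := by rw [hM']; simp only [if_true, add_zero]; exact (sbMat_compat (β₀ := β₀) hν0).2 }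
  -- STEP 3: the analytic branches and their coefficient bounds
  obtain ⟨-, hφcoef, hφball, -⟩ := hDφ.analyticBranch
  obtain ⟨-, hψcoef, hψball, -⟩ := hDψ.analyticBranch
  obtain ⟨vφ, hvφ⟩ : ∃ vφ : ℕ → ℂ × ℂ, vφ = frobeniusCoeff N (fun _ => (0 : ℂ × ℂ)) Rφ v₀ := ⟨_, rfl⟩
  obtain ⟨vψ, hvψ⟩ : ∃ vψ : ℕ → ℂ × ℂ, vψ = frobeniusCoeff M' (fun _ => (0 : ℂ × ℂ)) Rψ ((1 : ℂ), (0 : ℂ)) := ⟨_, rfl⟩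
  have hvφb : ∀ n, ‖vφ n‖ ≤ Bst * lam ^ n := fun n => by
    rw [hvφ, hlam]
    exact (hφcoef n).trans (mul_le_mul_of_nonneg_right (max_le hv₀norm (by rw [mul_zero]; exact hBst0))
      (pow_nonneg (by rw [← hlam]; exact hlam0.le) n))
  have hvψb : ∀ n, ‖vψ n‖ ≤ 1 * lam ^ n := fun n => by
    rw [hvψ, hlam]
    exact (hψcoef n).trans (mul_le_mul_of_nonneg_right (max_le (by simp) (by rw [mul_zero]; exact zero_le_one))
      (pow_nonneg (by rw [← hlam]; exact hlam0.le) n))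
  have hvψb' : ∀ n, ‖vψ n‖ ≤ Bst * lam ^ n := fun n =>
    (hvψb n).trans (mul_le_mul_of_nonneg_right (by linarith) (pow_nonneg hlam0.le n))
  have hvχb : ∀ n, ‖(vψ (n + 1)).2‖ ≤ Bst * lam ^ n := fun n => by
    refine (norm_snd_le _).trans ((hvψb (n + 1)).trans ?_)
    rw [one_mul, pow_succ]; nlinarith [pow_nonneg hlam0.le n]
  have hvφ0 : vφ 0 = v₀ := by rw [hvφ, frobeniusCoeff_zero]
  have hvψ0 : vψ 0 = ((1 : ℂ), (0 : ℂ)) := by rw [hvψ, frobeniusCoeff_zero]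
  -- the five scalar series
  have hb₁ : ∀ n, ‖(vφ n).1‖ ≤ Bst * lam ^ n := fun n => (norm_fst_le _).trans (hvφb n)
  have hb₂ : ∀ n, ‖(vφ n).2‖ ≤ Bst * lam ^ n := fun n => (norm_snd_le _).trans (hvφb n)
  have hb₃ : ∀ n, ‖(vψ n).1‖ ≤ Bst * lam ^ n := fun n => (norm_fst_le _).trans (hvψb' n)
  have hb₄ : ∀ n, ‖(vψ n).2‖ ≤ Bst * lam ^ n := fun n => (norm_snd_le _).trans (hvψb' n)
  obtain ⟨hs₁, hz₁, hd₁⟩ := hCs (fun n => (vφ n).1) Bst hb₁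
  obtain ⟨hs₂, hz₂, hd₂⟩ := hCs (fun n => (vφ n).2) Bst hb₂
  obtain ⟨hs₃, hz₃, hd₃⟩ := hCs (fun n => (vψ n).1) Bst hb₃
  obtain ⟨hs₄, hz₄, hd₄⟩ := hCs (fun n => (vψ n).2) Bst hb₄
  obtain ⟨hs₅, hz₅, hd₅⟩ := hCs (fun n => (vψ (n + 1)).2) Bst hvχb
  have hsubρ : Ioo (-ρ) ρ ⊆ Ioo (-ρ₁) ρ₁ := fun x hx => ⟨by linarith [hx.1], hx.2.trans_le hρρ₁⟩
  -- membership in the disc of convergence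
  have hdisc : ∀ x ∈ Ioo (-ρ₁) ρ₁, lam * ‖(x : ℂ)‖ < 1 := by
    intro x hx
    rw [Complex.norm_real, Real.norm_eq_abs]
    have hx' : |x| < ρ₁ := abs_lt.2 hx
    have h2 : (1 : ℝ) ≤ 2 ^ (k + 1 + 1) := one_le_pow₀ (by norm_num)
    have h3 : ρ₁ ≤ 1 / lam := by
      rw [hρ₁]; exact div_le_div_of_nonneg_left zero_le_one hlam0 (le_mul_of_one_le_left hlam0.le h2)
    calc lam * |x| < lam * ρ₁ := by gcongr
      _ ≤ lam * (1 / lam) := by gcongr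
      _ = 1 := mul_one_div_cancel hlam0.ne'
  -- the five functions (opaque names)
  obtain ⟨a₁, ha₁⟩ : ∃ f : ℝ → ℂ, f = fun y : ℝ => ∑' n, (y : ℂ) ^ n • (vφ n).1 := ⟨_, rfl⟩
  obtain ⟨a₂, ha₂⟩ : ∃ f : ℝ → ℂ, f = fun y : ℝ => ∑' n, (y : ℂ) ^ n • (vφ n).2 := ⟨_, rfl⟩
  obtain ⟨ψ₁, hψ₁⟩ : ∃ f : ℝ → ℂ, f = fun y : ℝ => ∑' n, (y : ℂ) ^ n • (vψ n).1 := ⟨_, rfl⟩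
  obtain ⟨ψ₂, hψ₂⟩ : ∃ f : ℝ → ℂ, f = fun y : ℝ => ∑' n, (y : ℂ) ^ n • (vψ n).2 := ⟨_, rfl⟩
  obtain ⟨χ, hχ⟩ : ∃ f : ℝ → ℂ, f = fun y : ℝ => ∑' n, (y : ℂ) ^ n • (vψ (n + 1)).2 := ⟨_, rfl⟩
  rw [← ha₁] at hs₁ hd₁; rw [← ha₂] at hs₂ hd₂; rw [← hψ₁] at hs₃ hd₃; rw [← hψ₂] at hs₄ hd₄; rw [← hχ] at hs₅ hd₅
  rw [← hCb] at hd₁ hd₂ hd₃ hd₄ hd₅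
  -- identification with the vector branches on the disc
  have hφdef : ∀ z : ℂ, frobeniusSol N (fun _ => (0 : ℂ × ℂ)) Rφ v₀ z = ∑' n, z ^ n • vφ n := fun z => by
    rw [hvφ]; rfl
  have hψdef : ∀ z : ℂ, frobeniusSol M' (fun _ => (0 : ℂ × ℂ)) Rψ ((1 : ℂ), (0 : ℂ)) z = ∑' n, z ^ n • vψ n :=
    fun z => by rw [hvψ]; rfl
  have hev : ∀ x ∈ Ioo (-ρ₁) ρ₁,
      ((fun y : ℝ => a₁ y) =ᶠ[𝓝 x] fun y => (frobeniusSol N (fun _ => (0 : ℂ × ℂ)) Rφ v₀ (y : ℂ)).1) ∧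
      ((fun y : ℝ => a₂ y) =ᶠ[𝓝 x] fun y => (frobeniusSol N (fun _ => (0 : ℂ × ℂ)) Rφ v₀ (y : ℂ)).2) ∧
      ((fun y : ℝ => ψ₁ y) =ᶠ[𝓝 x] fun y => (frobeniusSol M' (fun _ => (0 : ℂ × ℂ)) Rψ ((1 : ℂ), (0 : ℂ)) (y : ℂ)).1) ∧
      ((fun y : ℝ => ψ₂ y) =ᶠ[𝓝 x] fun y => (frobeniusSol M' (fun _ => (0 : ℂ × ℂ)) Rψ ((1 : ℂ), (0 : ℂ)) (y : ℂ)).2) := by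
    intro x hx
    refine ⟨?_, ?_, ?_, ?_⟩ <;> filter_upwards [isOpen_Ioo.mem_nhds hx] with y hy
    · rw [hφdef, ha₁]; exact (tsum_smul_fst_snd hvφb hlam0.le (hdisc y hy)).1
    · rw [hφdef, ha₂]; exact (tsum_smul_fst_snd hvφb hlam0.le (hdisc y hy)).2
    · rw [hψdef, hψ₁]; exact (tsum_smul_fst_snd hvψb hlam0.le (hdisc y hy)).1
    · rw [hψdef, hψ₂]; exact (tsum_smul_fst_snd hvψb hlam0.le (hdisc y hy)).2
  -- values at `0`
  have h0ρ₁ : (0 : ℝ) ∈ Ioo (-ρ₁) ρ₁ := ⟨by linarith, hρ₁0⟩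
  have ha₂0 : a₂ 0 = 1 := by rw [ha₂]; beta_reduce; rw [hz₂, hvφ0, hv₀]
  have hψ₁0 : ψ₁ 0 = 1 := by rw [hψ₁]; beta_reduce; rw [hz₃, hvψ0]
  have hψ₂0 : ψ₂ 0 = 0 := by rw [hψ₂]; beta_reduce; rw [hz₄, hvψ0]
  refine ⟨a₁, a₂, ψ₁, ψ₂, χ, hs₁.mono hsubρ, hs₂.mono hsubρ, hs₃.mono hsubρ, hs₄.mono hsubρ, hs₅.mono hsubρ, ha₂0,
    hψ₁0, ?_, ?_, ?_, fun i hi x hx => ?_⟩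
  · -- `ψ₂ = x χ`
    intro x hx
    have hz := hdisc x (hsubρ hx)
    obtain ⟨hshift, hwb⟩ := tsum_pow_smul_shift hvψb hlam0.le hz
    obtain ⟨-, e1⟩ := tsum_smul_fst_snd hvψb hlam0.le hz
    obtain ⟨-, e2⟩ := tsum_smul_fst_snd hwb hlam0.le hz
    rw [hψ₂, hχ]; beta_reduce
    rw [e1, e2, hshift, hvψ0]
    simp
  · -- the equations
    intro x hx m₁₁ m₁₂ m₂₁ m₂₂ h₁₁ h₁₂ h₂₁ h₂₂
    have hx₁ := hsubρ hx
    have hzθ : θ * (1 + 2 * cR * K) * ‖(x : ℂ)‖ < 1 := by rw [← hlam]; exact hdisc x hx₁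
    obtain ⟨-, hdiffφ, hodeφ, -⟩ := hφball (x : ℂ) hzθ
    obtain ⟨-, hdiffψ, hodeψ, -⟩ := hψball (x : ℂ) hzθ
    have hS : HasSum (fun n => (x : ℂ) ^ n • N n) (𝐌[m₁₁, m₁₂, m₂₁, m₂₂]) := by
      rw [hN]; simp only [smul_sbMat]; exact hasSum_sbMat h₁₁ h₁₂ h₂₁ h₂₂
    have hS' : HasSum (fun n => (x : ℂ) ^ n • M' n) (𝐌[m₁₁, m₁₂, m₂₁, m₂₂] - 𝐌[ν, 0, 0, ν]) := by
      have h2 : HasSum (fun n : ℕ => if n = 0 then (𝐌[ν, 0, 0, ν] : ℂ × ℂ →L[ℂ] ℂ × ℂ) else 0) (𝐌[ν, 0, 0, ν]) :=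
        hasSum_ite_eq 0 _
      refine (hS.sub h2).congr_fun fun n => ?_
      rw [hM']
      rcases eq_or_ne n 0 with rfl | hn
      · simp only [if_true, pow_zero, one_smul, hN0]
        module
      · simp only [if_neg hn, sub_zero]
    have hT0 : (∑' n : ℕ, (x : ℂ) ^ n • (0 : ℂ × ℂ)) = 0 := by simp
    rw [hS.tsum_eq, hT0, add_zero] at hodeφ
    rw [hS'.tsum_eq, hT0, add_zero] at hodeψ
    obtain ⟨e₁, e₂, e₃, e₄⟩ := hev x hx₁
    have hderφ := hasDerivAt_comp_ofReal (F := ℂ × ℂ) hdiffφ.hasDerivAt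
    have hderψ := hasDerivAt_comp_ofReal (F := ℂ × ℂ) hdiffψ.hasDerivAt
    have d₁ : deriv a₁ x = (deriv (frobeniusSol N (fun _ => (0 : ℂ × ℂ)) Rφ v₀) (x : ℂ)).1 := by
      rw [show deriv a₁ x = deriv (fun y => a₁ y) x from rfl, e₁.deriv_eq]
      simpa using hderφ.hasFDerivAt.fst.hasDerivAt.deriv
    have d₂ : deriv a₂ x = (deriv (frobeniusSol N (fun _ => (0 : ℂ × ℂ)) Rφ v₀) (x : ℂ)).2 := by
      rw [show deriv a₂ x = deriv (fun y => a₂ y) x from rfl, e₂.deriv_eq]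
      simpa using hderφ.hasFDerivAt.snd.hasDerivAt.deriv
    have d₃ : deriv ψ₁ x = (deriv (frobeniusSol M' (fun _ => (0 : ℂ × ℂ)) Rψ ((1 : ℂ), (0 : ℂ))) (x : ℂ)).1 := by
      rw [show deriv ψ₁ x = deriv (fun y => ψ₁ y) x from rfl, e₃.deriv_eq]
      simpa using hderψ.hasFDerivAt.fst.hasDerivAt.deriv
    have d₄ : deriv ψ₂ x = (deriv (frobeniusSol M' (fun _ => (0 : ℂ × ℂ)) Rψ ((1 : ℂ), (0 : ℂ))) (x : ℂ)).2 := by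
      rw [show deriv ψ₂ x = deriv (fun y => ψ₂ y) x from rfl, e₄.deriv_eq]
      simpa using hderψ.hasFDerivAt.snd.hasDerivAt.deriv
    have v₁ : a₁ x = (frobeniusSol N (fun _ => (0 : ℂ × ℂ)) Rφ v₀ (x : ℂ)).1 := e₁.self_of_nhds
    have v₂ : a₂ x = (frobeniusSol N (fun _ => (0 : ℂ × ℂ)) Rφ v₀ (x : ℂ)).2 := e₂.self_of_nhds
    have v₃ : ψ₁ x = (frobeniusSol M' (fun _ => (0 : ℂ × ℂ)) Rψ ((1 : ℂ), (0 : ℂ)) (x : ℂ)).1 := e₃.self_of_nhds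
    have v₄ : ψ₂ x = (frobeniusSol M' (fun _ => (0 : ℂ × ℂ)) Rψ ((1 : ℂ), (0 : ℂ)) (x : ℂ)).2 := e₄.self_of_nhds
    have f₁ := congrArg Prod.fst hodeφ
    have f₂ := congrArg Prod.snd hodeφ
    have f₃ := congrArg Prod.fst hodeψ
    have f₄ := congrArg Prod.snd hodeψ
    simp only [Prod.smul_fst, Prod.smul_snd, smul_eq_mul, sbMat_apply, sub_apply, Prod.fst_sub,
      Prod.snd_sub] at f₁ f₂ f₃ f₄
    rw [d₁, d₂, d₃, d₄, v₁, v₂, v₃, v₄]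
    exact ⟨⟨f₁, f₂⟩, by linear_combination f₃, by linear_combination f₄⟩
  · -- the Wronskian stays within `1/2` of `−1`
    intro x hx
    have hx₁ := hsubρ hx
    have hU₁ : IsOpen (Ioo (-ρ₁) ρ₁) := isOpen_Ioo
    have hdf : ∀ {f : ℝ → ℂ}, ContDiffOn ℝ ∞ f (Ioo (-ρ₁) ρ₁) → ∀ y ∈ Ioo (-ρ₁) ρ₁, HasDerivAt f (deriv f y) y :=
      fun hf y hy => ((hf.differentiableOn (by simp)) y hy |>.differentiableAt (hU₁.mem_nhds hy)).hasDerivAt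
    have hb0 : ∀ {f : ℝ → ℂ}, (∀ i ≤ k + 1, ∀ x ∈ Ioo (-ρ₁) ρ₁, ‖iteratedDeriv i f x‖ ≤ Cb) →
        ∀ y ∈ Ioo (-ρ₁) ρ₁, ‖f y‖ ≤ Cb ∧ ‖deriv f y‖ ≤ Cb := fun hf y hy =>
      ⟨by simpa using hf 0 (Nat.zero_le _) y hy, by simpa using hf 1 (by omega) y hy⟩
    have hwd : ∀ y ∈ Ioo (-ρ₁) ρ₁, HasDerivAt (fun y => a₁ y * ψ₂ y - a₂ y * ψ₁ y)
        (deriv a₁ y * ψ₂ y + a₁ y * deriv ψ₂ y - (deriv a₂ y * ψ₁ y + a₂ y * deriv ψ₁ y)) y := fun y hy =>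
      ((hdf hs₁ y hy).mul (hdf hs₄ y hy)).sub ((hdf hs₂ y hy).mul (hdf hs₃ y hy))
    have hwb : ∀ y ∈ Ioo (-ρ₁) ρ₁,
        ‖deriv a₁ y * ψ₂ y + a₁ y * deriv ψ₂ y - (deriv a₂ y * ψ₁ y + a₂ y * deriv ψ₁ y)‖ ≤ 4 * Cb ^ 2 := by
      intro y hy
      obtain ⟨b₁, b₁'⟩ := hb0 hd₁ y hy
      obtain ⟨b₂, b₂'⟩ := hb0 hd₂ y hy
      obtain ⟨b₃, b₃'⟩ := hb0 hd₃ y hy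
      obtain ⟨b₄, b₄'⟩ := hb0 hd₄ y hy
      have hm : ∀ {u v : ℂ}, ‖u‖ ≤ Cb → ‖v‖ ≤ Cb → ‖u * v‖ ≤ Cb * Cb := fun hu hv => by
        rw [norm_mul]; exact mul_le_mul hu hv (norm_nonneg _) hCb0
      calc _ ≤ ‖deriv a₁ y * ψ₂ y + a₁ y * deriv ψ₂ y‖ + ‖deriv a₂ y * ψ₁ y + a₂ y * deriv ψ₁ y‖ := norm_sub_le _ _
        _ ≤ (Cb * Cb + Cb * Cb) + (Cb * Cb + Cb * Cb) :=
            add_le_add ((norm_add_le _ _).trans (add_le_add (hm b₁' b₄) (hm b₁ b₄')))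
              ((norm_add_le _ _).trans (add_le_add (hm b₂' b₃) (hm b₂ b₃')))
        _ = 4 * Cb ^ 2 := by ring
    have hsub0 : uIcc 0 x ⊆ Ioo (-ρ₁) ρ₁ := by
      intro y hy
      have hyx : |y| ≤ |x| := by
        rcases mem_uIcc.1 hy with h | h
        · rw [abs_of_nonneg h.1, abs_of_nonneg (h.1.trans h.2)]; exact h.2
        · rw [abs_of_nonpos h.2, abs_of_nonpos (h.1.trans h.2)]; linarith [h.1]
      exact abs_lt.1 (hyx.trans_lt ((abs_lt.2 hx).trans_le hρρ₁))
    have key := Convex.norm_image_sub_le_of_norm_hasDerivWithin_le (f := fun y => a₁ y * ψ₂ y - a₂ y * ψ₁ y)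
      (fun y hy => (hwd y (hsub0 hy)).hasDerivWithinAt) (fun y hy => hwb y (hsub0 hy)) (convex_uIcc 0 x)
      left_mem_uIcc right_mem_uIcc
    have hw0 : a₁ 0 * ψ₂ 0 - a₂ 0 * ψ₁ 0 = -1 := by rw [hψ₂0, ha₂0, hψ₁0]; ring
    simp only [hw0, sub_neg_eq_add, sub_zero, Real.norm_eq_abs] at key
    have h4 : 4 * Cb ^ 2 * |x| ≤ 1 / 2 := by
      have hxρ : |x| ≤ 1 / (8 * Cb ^ 2 + 8) := (abs_lt.2 hx).le.trans hρCb
      have hpos : (0 : ℝ) < 8 * Cb ^ 2 + 8 := by linarith only [sq_nonneg Cb]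
      calc 4 * Cb ^ 2 * |x| ≤ 4 * Cb ^ 2 * (1 / (8 * Cb ^ 2 + 8)) :=
            mul_le_mul_of_nonneg_left hxρ (by linarith only [sq_nonneg Cb])
        _ ≤ 1 / 2 := by
            rw [mul_one_div, div_le_iff₀ hpos]
            linarith only [sq_nonneg Cb]
    exact key.trans h4
  · exact ⟨hd₁ i (by omega) x (hsubρ hx), hd₂ i (by omega) x (hsubρ hx), hd₃ i (by omega) x (hsubρ hx),
      hd₄ i (by omega) x (hsubρ hx), hd₅ i (by omega) x (hsubρ hx)⟩


end Summit.AtomisticToContinuum.HydrodynamicLimit.Theorems.SonicCavityRenewal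

end
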